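import Summits.QuantumFields.BalabanUV.Beta.SecondOrderTableLawEnd
import Summits.QuantumFields.BalabanUV.Beta.GAN24.CombQuarticTableLawTwinsC
import Summits.QuantumFields.BalabanUV.Beta.RootedBorderTableLaw

-- `BalabanUV.Beta.GAN24.CombQuarticTableLawTwinsD`: W-an2-1 twin chain, links CombQuarticTableLawTableLawEnd, CombQuarticTableLawLiteral (one module per ≤ 400-line group; each link keeps its own module docstring, section and namespace).

/-!
# `BalabanUV.Beta.GAN24.CombQuarticTableLawTableLawEnd` — binder row G-an2-4 ∕ (CONV-C), W-slot, row (C) at levels ≥ 1, WANTED W-an2-1 (the quartic TABLE-level reflection law of the comb tower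
# at the literal), EIGHTH TWIN OF an2's END CHAIN: **THE QUARTIC TABLE LAW FOR THE ROW LITERAL's TABLES (`T_W`, `vh₂SAn1 Lc`, `mixFFAt ρ_c Lc`) ⟸ an1's MIXED TABLE LAW `hM` ∧ THE PURE-SIGN BORDER STATEMENT `hInv`** (+ `cΛ·Lc⁴ = 2`, lock2) — an2 gen 21's `SecondOrderTableLawEnd.…_of_tableLaw_an1_suN` VERBATIM (`MixedLetterPacking.mixedBinders_of_tableLaw`, `border_prim_of_zero` ∘ `borderAt_zero_an1_iff`, every data hypothesis of `vh₂SAn1` discharged) over MY `CombQuarticTableLawLetterLevels.T2RecAt_bref_all_of_an1_letters₀_suN` instead of the kernel END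
# (road-P2 chair of row G-an2-4, unit `b2b-balaban-gan24-p2` gen 48, crux team (2))

NOT IN PRINT; OUR BOOKKEEPING ([folklore] wiring BY NAME; twin of an2's END with the root call swapped and the kernel-only binders dropped; 0 `def`, 0 cited facts, 0 `def … : Prop`,
0 sorry).  HONEST FRAMING (cell contract, verbatim): «discharging `BetaPertH` makes Bałaban's UV stability UNCONDITIONAL — a real constructive-QFT result; it is NOT the continuum
limit and NOT the Clay problem.»  HONEST DEPENDENCY (verbatim): «continuum YM on T⁴ ⇐ BetaPertH ∧ nine spine estimates (0/9 proved); BetaPertH ⇐ (D1) ∧ (D4) ∧ CAP+tail; G-an2-4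
gates asym, D1 and NE2/3/4.»

WHAT.  **`T2RecAt_bref_all_of_tableLaw_an1_suN (hLc : Odd Lc) (hN : 2 ≤ N) (hΛ : cΛ·Lc⁴ = 2) (cE₂ cB) (γ hγ) (hlock2) (hM) (hInv)`**: the `∃ R2`-form quartic table law for `T := (8N²)⁻¹ • wsym22 N`, `vh₂S := vh₂SAn1 Lc`, `mixFF := mixFFAt ρ_c Lc` — TWO displayed identities about an1's averaging tables left (discharged by the next twins).
EVERY LETTER NOT YET DISCHARGED IS A HYPOTHESIS; discharges NOTHING of (C)_{≥1} ∕ (Q-L) ∕ (H1♮); (β) of record untouched; NEVER «G-an2-4 closed» as (CONV-C); NOT D1, NOT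
`BetaPertH`, NOT continuum, NOT Clay.  2026-08-23; no existing file touched.
-/

noncomputable section

open Finset
open scoped BigOperators
open Literature.MathematicalPhysics.QuantumFieldTheory
open Literature.MathematicalPhysics.QuantumFieldTheory.Balaban1983to89
open Literature.MathematicalPhysics.QuantumFieldTheory.Balaban1983to89.Beta
open B12Sec2to5 (l1 l1_nonneg)
open ExpKernelCalculus (MKer BiLoc comp shiftK l1_sub_triangle l1_sub_symm)
open AffineAveraging (box toSite)
open AveragingContoursRooted (ctr ctrOff ctrOff_mem_box)
open AveragingHessianKernelsRooted (hessFFAt linKerAt)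
open AveragingMixedJetTables (vh₂SAt mixFFAt vh2Abs vh2Abs_nonneg biLoc_vh₂SAt vh₂SAt_translate)
open PolarizationSign (reflSign AxisReflectionCovariant)
open KernelReflection (refK refK_apply)
open ResolventReflection (bref Φ)
open OneStepResolventKernel (Fib)
open OneStepKernelFamily (TbalOf flipK)
open ColourTrace (Complete TrOrthonormal)
open WilsonVertex2Sym (wsym22)
open KernelWard (biLoc_add)
open StepJetData (biLoc_weaken biLoc_smul)
open BalabanStepJetsSucc (wE wVH)
open BalabanCompositeJets (LocStencil₂)
open BalabanStepW2 (wV4 wB2)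
open SecondOrderResponse (LocStencilFM)
open Summit.QuantumFields.BalabanUV.Beta.ChartConjugation (conjV conjW)
open Summit.QuantumFields.BalabanUV.Beta.BorderedHessian (diagK ctGen stepScale sgnK)
open Summit.QuantumFields.BalabanUV.Beta.SpineRooted (JsRecWAtOf)
open Summit.QuantumFields.BalabanUV.Beta.MixedJetTablesPlug (hmix_an1)
open Summit.QuantumFields.BalabanUV.Beta.SecondOrderBorderGauge (actB)
open Summit.QuantumFields.BalabanUV.Beta.SecondOrderBorderModel (Twall vh₂SModel)
open Summit.QuantumFields.BalabanUV.Beta.SecondOrderBorderModelClass (locStencil₂_vh₂SModel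
  axisReflectionCovariant_flipK_TbalOf_JsRecWAtOf_of_mixed_letter_model axisReflectionCovariant_flipK_TbalOf_JsRecWAtOf_of_mixed_letter_model_suN)
open Summit.QuantumFields.BalabanUV.Beta.SecondOrderLetterLevels (BorderPrim BorderAt MixedPrim border_prim_of_zero
  axisReflectionCovariant_flipK_TbalOf_JsRecWAtOf_of_an1_letters₀ axisReflectionCovariant_flipK_TbalOf_JsRecWAtOf_of_an1_letters₀_suN)
open Summit.QuantumFields.BalabanUV.Beta.SecondOrderSocketIdentification (atw vh₂SAn1 vh₂SAn1_inl_inl vh₂SAn1_inr_inr vh₂SAn1_antiTwin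
  borderAt_zero_an1_iff)
open Summit.QuantumFields.BalabanUV.Beta.MixedLetterPacking (RMof mixedBinders_of_tableLaw)


namespace Summit.QuantumFields.BalabanUV.Beta.GAN24.CombQuarticTableLawTableLawEnd

open Summit.QuantumFields.BalabanUV.Beta.TameKernelCalculus
open Summit.QuantumFields.BalabanUV.Beta.SpineRooted
open Summit.QuantumFields.BalabanUV.Beta.SecondOrderLetterLevels
open Summit.QuantumFields.BalabanUV.Beta.SecondOrderTableLawEnd
open Summit.QuantumFields.BalabanUV.Beta.GAN24.CombQuarticTableLawLetterLevels (T2RecAt_bref_all_of_an1_letters₀_suN)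

variable {Lc : ℕ} [NeZero Lc]

/-- NOT IN PRINT; OUR BOOKKEEPING (table-law twin of an2's `axisReflectionCovariant_flipK_TbalOf_JsRecWAtOf_of_tableLaw_an1_suN`; see the module docstring). -/
theorem T2RecAt_bref_all_of_tableLaw_an1_suN (hLc : Odd Lc) {N : ℕ} (hN : 2 ≤ N) {cΛ : ℝ}
    (hΛ : cΛ * (Lc : ℝ) ^ 4 = 2) (cE₂ cB : ℝ) (γ : ℕ → ℝ)
    (hγ : ∀ j, γ j = -((Lc : ℝ) ^ 8 / 2) * wVH 3 Lc j / (stepScale 3 Lc j * (Lc : ℝ) ^ 4))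
    (hlock2 : ∀ j, cE₂ * wV4 3 Lc (j + 1) * wVH 3 Lc (j + 1) = ((Lc : ℝ) ^ 4 * wE 3 Lc (j + 1)) ^ 2)
    (hM : ∀ (α κ : Fin 4) (u : Fin 4 → ℤ) (ρ' : Fin 4) (w : Fin 4 → ℤ),
      mixFFAt (toSite (ctrOff 4 Lc)) Lc κ (bref α κ u) ρ' (bref α ρ' w) =
        (reflSign α κ * reflSign α ρ') • refK (Φ Lc α)
          (mixFFAt (toSite (ctrOff 4 Lc)) Lc κ u ρ' w
            + (2 : ℝ) • comp (diagK (ctGen 3 α Lc κ u)) (hessFFAt (toSite (ctrOff 4 Lc)) Lc ρ' w)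
            + (2 * (if ρ' = α then linKerAt (toSite (ctrOff 4 Lc)) Lc ρ' w (κ, u) else 0)) • hessFFAt (toSite (ctrOff 4 Lc)) Lc ρ' w))
    (hInv : ∀ (α κ : Fin 4) (u : Fin 4 → ℤ) (κ' : Fin 4) (u' x z : Fin 4 → ℤ) (β m : Fin 4),
      (actB Lc α (cB • vh₂SAn1 Lc - Twall Lc cΛ γ) - (cB • vh₂SAn1 Lc - Twall Lc cΛ γ)) κ u κ' u' x z (Sum.inl β) (Sum.inr m) = 0)
    :
    ∃ R2 : ℕ → Fin 4 → Fin 4 → (Fin 4 → ℤ) → Fin 4 → (Fin 4 → ℤ) → ExpKernelCalculus.MKer 4 (OneStepResolventKernel.Fib 3),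
      (∀ (j : ℕ) (α : Fin 4), ∃ C δ : ℝ, 0 < δ ∧ BalabanCompositeJets.LocStencil₂ (R2 j α) C δ) ∧
      (∀ (j : ℕ) (α : Fin 4) κ u κ' u', TameKernelCalculus.trK (R2 j α κ u κ' u') = -BorderedHessian.sgnK (R2 j α κ u κ' u')) ∧
      ∀ (j : ℕ) (α κ : Fin 4) (u : Fin 4 → ℤ) (κ' : Fin 4) (u' : Fin 4 → ℤ),
        SpineRooted.T2RecAt 3 Lc (AffineAveraging.toSite (AveragingContoursRooted.ctrOff 4 Lc)) ((Lc : ℝ) ^ 4) (-((Lc : ℝ) ^ 8 / 2)) cΛ cE₂ cB ((8 * (N : ℝ) ^ 2)⁻¹ • wsym22 N) (vh₂SAn1 Lc) (mixFFAt (AffineAveraging.toSite (AveragingContoursRooted.ctrOff 4 Lc)) Lc) j κ (ResolventReflection.bref α κ u) κ' (ResolventReflection.bref α κ' u') =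
          (PolarizationSign.reflSign α κ * PolarizationSign.reflSign α κ') • KernelReflection.refK (ResolventReflection.Φ Lc α)
            (SpineRooted.T2RecAt 3 Lc (AffineAveraging.toSite (AveragingContoursRooted.ctrOff 4 Lc)) ((Lc : ℝ) ^ 4) (-((Lc : ℝ) ^ 8 / 2)) cΛ cE₂ cB ((8 * (N : ℝ) ^ 2)⁻¹ • wsym22 N) (vh₂SAn1 Lc) (mixFFAt (AffineAveraging.toSite (AveragingContoursRooted.ctrOff 4 Lc)) Lc) j κ u κ' u' +
              ChartConjugation.conjW (BorderedHessian.bhKStepAt 3 (AffineAveraging.toSite (AveragingContoursRooted.ctrOff 4 Lc)) Lc j)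
                (SpineRooted.SpureRecAt 3 Lc (AffineAveraging.toSite (AveragingContoursRooted.ctrOff 4 Lc)) ((Lc : ℝ) ^ 4) (-((Lc : ℝ) ^ 8 / 2)) cΛ j κ u)
                (SpineRooted.SpureRecAt 3 Lc (AffineAveraging.toSite (AveragingContoursRooted.ctrOff 4 Lc)) ((Lc : ℝ) ^ 4) (-((Lc : ℝ) ^ 8 / 2)) cΛ j κ' u')
                (BorderedHessian.diagK fun p c => γ j * BorderedHessian.ctGen 3 α Lc κ u p c) (BorderedHessian.diagK fun p c => γ j * BorderedHessian.ctGen 3 α Lc κ' u' p c) (BorderedHessian.diagK fun p c => γ j ^ 2 * (BorderedHessian.ctGen 3 α Lc κ u p c * BorderedHessian.ctGen 3 α Lc κ' u' p c)) +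
              R2 j α κ u κ' u') := by
  obtain ⟨hM₀, hRM₀c, hRM₀p⟩ := mixedBinders_of_tableLaw hLc hΛ hM
  have hB₀ : BorderPrim Lc (toSite (ctrOff 4 Lc)) cB (vh₂SAn1 Lc) :=
    border_prim_of_zero (toSite (ctrOff 4 Lc)) cΛ cB hγ ((borderAt_zero_an1_iff hLc cΛ cB γ hγ).2 hInv)
  exact T2RecAt_bref_all_of_an1_letters₀_suN hLc hN cΛ cE₂ cB (locStencil₂_vh₂SAn1 hLc)
    (vh₂SAn1_inl_inl (Lc := Lc)) γ hγ hlock2 (RMof Lc cΛ) hM₀ hRM₀c hRM₀p (vh₂SAn1_antiTwin (Lc := Lc)) (vh₂SAn1_inr_inr (Lc := Lc)) hB₀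

end Summit.QuantumFields.BalabanUV.Beta.GAN24.CombQuarticTableLawTableLawEnd

end

/-!
# `BalabanUV.Beta.GAN24.CombQuarticTableLawLiteral` — binder row G-an2-4 ∕ (CONV-C), W-slot, row (C) at levels ≥ 1: **WANTED W-an2-1 DELIVERED — THE QUARTIC TABLE-LEVEL
# REFLECTION LAW OF THE COMB TOWER AT THE LITERAL OF RECORD `JsRowD1Pin hLc N`, HYPOTHESES `Odd Lc` AND `2 ≤ N` ONLY** — the last four links of an2's ∕ leaf-05's kernel-hR chain
# (`RowD1JointEnd.…_JsRowD1_of_letters` → `RowD1FromBondLaws.…_of_bondLaws` → `RowD1MixedDischarged.…_of_borderBondLaw` ∕ `…_JsRowD1Pin_of_borderBondLaw` →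
# `RootedBorderTableLaw.…_JsRowD1Pin`) twinned VERBATIM over MY `CombQuarticTableLawTableLawEnd.T2RecAt_bref_all_of_tableLaw_an1_suN`: lock2 at the pin `cE₂ = Lc⁸`
# (`lock2_of_bcj2`), an1's mixed table law from an3's mixed bond law (`MixedLetterUnpacking.tableLaw_iff_bondLaw` ∘ `RootedMixedTableLaw.bondLaw`), the pure-sign border statement
# from an3's border bond law (`BorderLetterPacking.borderInv_of_bondLaw` ∘ `RootedBorderTableLaw.bondLaw`), the Λ-lock `lockΛ_pin`
# (road-P2 chair of row G-an2-4, unit `b2b-balaban-gan24-p2` gen 48, crux team (2))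

NOT IN PRINT; OUR BOOKKEEPING ([folklore] wiring BY NAME; twin of an2's END with the root call swapped and the kernel-only binders dropped; 0 `def`, 0 cited facts, 0 `def … : Prop`,
0 sorry).  HONEST FRAMING (cell contract, verbatim): «discharging `BetaPertH` makes Bałaban's UV stability UNCONDITIONAL — a real constructive-QFT result; it is NOT the continuum
limit and NOT the Clay problem.»  HONEST DEPENDENCY (verbatim): «continuum YM on T⁴ ⇐ BetaPertH ∧ nine spine estimates (0/9 proved); BetaPertH ⇐ (D1) ∧ (D4) ∧ CAP+tail; G-an2-4
gates asym, D1 and NE2/3/4.»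

WHAT.  §1 `T2RecAt_bref_all_JsRowD1_of_letters` (⟸ `hM`, `hInv`; `cE₂ := Lc⁸`); §2 `T2RecAt_bref_all_JsRowD1_of_bondLaws` (⟸ an3-shaped bond laws `hMb`, `hBb`; `cB := −Lc¹²∕4`);
§3 `T2RecAt_bref_all_JsRowD1_of_borderBondLaw` (⟸ `hBb` alone, `γ` instantiated); §4 **`T2RecAt_bref_all_JsRowD1Pin (hLc : Odd Lc) (hN : 2 ≤ N)`**:
`∃ R2, (∀ j α, LocStencil₂ (R2 j α)) ∧ (∀ j α, row-parity-odd (R2 j α)) ∧ ∀ j α κ u κ′ u′, T̂_j κ (bref α κ u) κ′ (bref α κ′ u′) = (ε_κ ε_κ′) • refK (Φ Lc α) (T̂_j κ u κ′ u′ +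
conjW 𝕄_j (S_j κ u) (S_j κ′ u′) (diagK (γ_j·ctGen α κ u)) (diagK (γ_j·ctGen α κ′ u′)) (diagK (γ_j²·ctGen α κ u·ctGen α κ′ u′)) + R2 j α κ u κ′ u′)` for THE LITERAL's quartic table
`T̂_j = T2RecAt 3 Lc ρ_c Lc⁴ (−Lc⁸∕2) (2∕Lc⁴) Lc⁸ (−Lc¹²∕4) ((8N²)⁻¹•wsym22 N) (vh₂SAn1 Lc) (mixFFAt ρ_c Lc) j` (the T₂ table of `RowD1JointEnd.JsRowD1Pin hLc N` — the
pins of MY capstones `WrecAtEvenHalfRowsOf…`), `γ_j = −(Lc⁸∕2)·wVH j ∕ (stepScale j·Lc⁴)` — NO letter left.  CONSUMER: MY `CombChargeParityOddOfQuarticLaw` (`hR2c`, `hR2p`, `hlaw`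
= the three conjuncts at level `j`, `γ := γ_j`, `γ₂ := γ_j²`) ⇒ the literal's member charges are leg-antisymmetric on every odd-axis pattern, every level (the companion corollary file).
HONEST: every line of mathematics here is an2's ∕ leaf-05's ∕ an1's ∕ an3's, re-plumbed to stop one step short of the kernel; this file discharges NO binder of the D1 wall and
NOTHING of (C)_{≥1} ∕ (Q-L) ∕ (H1♮) by itself; (β) of record untouched; NEVER «G-an2-4 closed» as (CONV-C); NOT D1, NOT `BetaPertH`, NOT continuum, NOT Clay.  2026-08-23;
no existing file touched.
-/

noncomputable section

open Finset
open scoped BigOperators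
open Literature.MathematicalPhysics.QuantumFieldTheory
open Literature.MathematicalPhysics.QuantumFieldTheory.Balaban1983to89
open Literature.MathematicalPhysics.QuantumFieldTheory.Balaban1983to89.Beta
open ExpKernelCalculus (MKer VertexFamily)
open AffineAveraging (box toSite)
open AveragingContours (blk off)
open AveragingContoursRooted (ctrOff)
open AveragingHessianKernelsRooted (vhKerAt linKerAt hessKerAt)
open AveragingMixedJetTables (vh2KerAt mixKerAt)
open PolarizationSign (reflSign WardTransversal AxisReflectionCovariant)
open ResolventReflection (bref)
open OneStepResolventKernel (Fib JetData)
open OneStepKernelFamily (TbalOf flipK D1Tel D1Rep D1Drift d1Drift_of_D1Tel_D1Rep)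
open Literature.MathematicalPhysics.QuantumFieldTheory.Balaban1983to89.Beta.VectorTailsLoc (fam kfam)
open Literature.MathematicalPhysics.QuantumFieldTheory.Balaban1983to89.Beta.VectorLegVolumeAdapter (MvE)
open B6BondElimination (unitVec)
open BalabanStepJetsSucc (wVH)
open BalabanStepW2 (wM1 wM2)
open Summit.QuantumFields.BalabanUV.Beta.BorderedHessian (stepScale sgnK)
open Summit.QuantumFields.BalabanUV.Beta.RowD1JointEnd (JsRowD1 JsRowD1Pin lockΛ_pin axisReflectionCovariant_flipK_TbalOf_JsRowD1_of_letters
  symmetries_JsRowD1_of_letters)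
open Summit.QuantumFields.BalabanUV.Beta.MixedLetterUnpacking (tableLaw_iff_bondLaw)
open Summit.QuantumFields.BalabanUV.Beta.BorderLetterPacking (borderInv_of_bondLaw)
open Summit.QuantumFields.BalabanUV.Beta.WardLettersUnpacking (hBord0_of_bondWard hBord0''_of_bondWard)
open Summit.QuantumFields.BalabanUV.Beta.MixedWardPacking (RWof mixedWardBinders_of_bondLaw)

namespace Summit.QuantumFields.BalabanUV.Beta.GAN24.CombQuarticTableLawLiteral

open Summit.QuantumFields.BalabanUV.Beta.TameKernelCalculus
open Summit.QuantumFields.BalabanUV.Beta.SpineRooted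
open Summit.QuantumFields.BalabanUV.Beta.RowD1JointEnd
open Summit.QuantumFields.BalabanUV.Beta.RowD1FromBondLaws
open Summit.QuantumFields.BalabanUV.Beta.RowD1MixedDischarged
open Summit.QuantumFields.BalabanUV.Beta.SecondOrderTableLawEnd
open Summit.QuantumFields.BalabanUV.Beta.MixedLetterUnpacking (tableLaw_iff_bondLaw)
open Summit.QuantumFields.BalabanUV.Beta.BorderLetterPacking (borderInv_of_bondLaw)
open Summit.QuantumFields.BalabanUV.Beta.GAN24.CombQuarticTableLawTableLawEnd (T2RecAt_bref_all_of_tableLaw_an1_suN)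

variable {Lc : ℕ} [NeZero Lc]

/-- NOT IN PRINT; OUR BOOKKEEPING.  §1 **THE QUARTIC TABLE LAW FOR `JsRowD1 hLc N cΛ cB`'s T₂ TABLE ⟸ an1's MIXED TABLE LAW `hM` ∧ THE PURE-SIGN BORDER STATEMENT `hInv`**
(+ `cΛ·Lc⁴ = 2`; lock2 discharged at `cE₂ = Lc⁸`) — twin of `RowD1JointEnd.…_JsRowD1_of_letters`. -/
theorem T2RecAt_bref_all_JsRowD1_of_letters (hLc : Odd Lc) {N : ℕ} (hN : 2 ≤ N) {cΛ : ℝ}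
    (hΛ : cΛ * (Lc : ℝ) ^ 4 = 2) (cB : ℝ) (γ : ℕ → ℝ)
    (hγ : ∀ j, γ j = -((Lc : ℝ) ^ 8 / 2) * wVH 3 Lc j / (stepScale 3 Lc j * (Lc : ℝ) ^ 4))
    (hM : ∀ (α κ : Fin 4) (u : Fin 4 → ℤ) (ρ' : Fin 4) (w : Fin 4 → ℤ),
      AveragingMixedJetTables.mixFFAt (AffineAveraging.toSite (AveragingContoursRooted.ctrOff 4 Lc)) Lc κ (ResolventReflection.bref α κ u) ρ' (ResolventReflection.bref α ρ' w) =
        (PolarizationSign.reflSign α κ * PolarizationSign.reflSign α ρ') • KernelReflection.refK (ResolventReflection.Φ Lc α)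
          (AveragingMixedJetTables.mixFFAt (AffineAveraging.toSite (AveragingContoursRooted.ctrOff 4 Lc)) Lc κ u ρ' w
            + (2 : ℝ) • ExpKernelCalculus.comp (BorderedHessian.diagK (BorderedHessian.ctGen 3 α Lc κ u)) (AveragingHessianKernelsRooted.hessFFAt (AffineAveraging.toSite (AveragingContoursRooted.ctrOff 4 Lc)) Lc ρ' w)
            + (2 * (if ρ' = α then AveragingHessianKernelsRooted.linKerAt (AffineAveraging.toSite (AveragingContoursRooted.ctrOff 4 Lc)) Lc ρ' w (κ, u) else 0)) • AveragingHessianKernelsRooted.hessFFAt (AffineAveraging.toSite (AveragingContoursRooted.ctrOff 4 Lc)) Lc ρ' w))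
    (hInv : ∀ (α κ : Fin 4) (u : Fin 4 → ℤ) (κ' : Fin 4) (u' x z : Fin 4 → ℤ) (β m : Fin 4),
      (SecondOrderBorderGauge.actB Lc α (cB • SecondOrderSocketIdentification.vh₂SAn1 Lc - SecondOrderBorderModel.Twall Lc cΛ γ) - (cB • SecondOrderSocketIdentification.vh₂SAn1 Lc - SecondOrderBorderModel.Twall Lc cΛ γ)) κ u κ' u' x z (Sum.inl β) (Sum.inr m) = 0)
    :
    ∃ R2 : ℕ → Fin 4 → Fin 4 → (Fin 4 → ℤ) → Fin 4 → (Fin 4 → ℤ) → ExpKernelCalculus.MKer 4 (OneStepResolventKernel.Fib 3),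
      (∀ (j : ℕ) (α : Fin 4), ∃ C δ : ℝ, 0 < δ ∧ BalabanCompositeJets.LocStencil₂ (R2 j α) C δ) ∧
      (∀ (j : ℕ) (α : Fin 4) κ u κ' u', TameKernelCalculus.trK (R2 j α κ u κ' u') = -BorderedHessian.sgnK (R2 j α κ u κ' u')) ∧
      ∀ (j : ℕ) (α κ : Fin 4) (u : Fin 4 → ℤ) (κ' : Fin 4) (u' : Fin 4 → ℤ),
        SpineRooted.T2RecAt 3 Lc (AffineAveraging.toSite (AveragingContoursRooted.ctrOff 4 Lc)) ((Lc : ℝ) ^ 4) (-((Lc : ℝ) ^ 8 / 2)) cΛ ((Lc : ℝ) ^ 8) cB ((8 * (N : ℝ) ^ 2)⁻¹ • WilsonVertex2Sym.wsym22 N) (SecondOrderSocketIdentification.vh₂SAn1 Lc) (AveragingMixedJetTables.mixFFAt (AffineAveraging.toSite (AveragingContoursRooted.ctrOff 4 Lc)) Lc) j κ (ResolventReflection.bref α κ u) κ' (ResolventReflection.bref α κ' u') =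
          (PolarizationSign.reflSign α κ * PolarizationSign.reflSign α κ') • KernelReflection.refK (ResolventReflection.Φ Lc α)
            (SpineRooted.T2RecAt 3 Lc (AffineAveraging.toSite (AveragingContoursRooted.ctrOff 4 Lc)) ((Lc : ℝ) ^ 4) (-((Lc : ℝ) ^ 8 / 2)) cΛ ((Lc : ℝ) ^ 8) cB ((8 * (N : ℝ) ^ 2)⁻¹ • WilsonVertex2Sym.wsym22 N) (SecondOrderSocketIdentification.vh₂SAn1 Lc) (AveragingMixedJetTables.mixFFAt (AffineAveraging.toSite (AveragingContoursRooted.ctrOff 4 Lc)) Lc) j κ u κ' u' +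
              ChartConjugation.conjW (BorderedHessian.bhKStepAt 3 (AffineAveraging.toSite (AveragingContoursRooted.ctrOff 4 Lc)) Lc j)
                (SpineRooted.SpureRecAt 3 Lc (AffineAveraging.toSite (AveragingContoursRooted.ctrOff 4 Lc)) ((Lc : ℝ) ^ 4) (-((Lc : ℝ) ^ 8 / 2)) cΛ j κ u)
                (SpineRooted.SpureRecAt 3 Lc (AffineAveraging.toSite (AveragingContoursRooted.ctrOff 4 Lc)) ((Lc : ℝ) ^ 4) (-((Lc : ℝ) ^ 8 / 2)) cΛ j κ' u')
                (BorderedHessian.diagK fun p c => γ j * BorderedHessian.ctGen 3 α Lc κ u p c) (BorderedHessian.diagK fun p c => γ j * BorderedHessian.ctGen 3 α Lc κ' u' p c) (BorderedHessian.diagK fun p c => γ j ^ 2 * (BorderedHessian.ctGen 3 α Lc κ u p c * BorderedHessian.ctGen 3 α Lc κ' u' p c)) +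
              R2 j α κ u κ' u') :=
  T2RecAt_bref_all_of_tableLaw_an1_suN hLc hN hΛ ((Lc : ℝ) ^ 8) cB γ hγ (fun j => lock2_of_bcj2 ((Lc : ℝ) ^ 8) rfl j) hM hInv

open Classical in
/-- NOT IN PRINT; OUR BOOKKEEPING.  §2 **… ⟸ THE TWO REFLECTION BOND LAWS ON an1's TABLES** (mixed `hMb`, border `hBb`; `cB := −Lc¹²∕4`) — twin of
`RowD1FromBondLaws.…_JsRowD1_of_bondLaws` (`tableLaw_iff_bondLaw`, `borderInv_of_bondLaw`). -/
theorem T2RecAt_bref_all_JsRowD1_of_bondLaws (hLc : Odd Lc) {N : ℕ} (hN : 2 ≤ N) {cΛ : ℝ}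
    (hΛ : cΛ * (Lc : ℝ) ^ 4 = 2) (γ : ℕ → ℝ)
    (hγ : ∀ j, γ j = -((Lc : ℝ) ^ 8 / 2) * wVH 3 Lc j / (stepScale 3 Lc j * (Lc : ℝ) ^ 4))
    (hMb : ∀ (α κ : Fin 4) (u : Fin 4 → ℤ) (ρ' : Fin 4) (w : Fin 4 → ℤ) (β : Fin 4) (x : Fin 4 → ℤ) (β' : Fin 4) (z : Fin 4 → ℤ),
      mixKerAt (AffineAveraging.toSite (AveragingContoursRooted.ctrOff 4 Lc)) Lc ρ' (ResolventReflection.bref α ρ' w) (κ, ResolventReflection.bref α κ u) (β, x) (β', z)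
        = PolarizationSign.reflSign α κ * PolarizationSign.reflSign α ρ' * (PolarizationSign.reflSign α β * PolarizationSign.reflSign α β' *
            (mixKerAt (AffineAveraging.toSite (AveragingContoursRooted.ctrOff 4 Lc)) Lc ρ' w (κ, u) (β, ResolventReflection.bref α β x) (β', ResolventReflection.bref α β' z)
              + 2 * (if ResolventReflection.bref α β x = u ∧ β = κ ∧ κ = α then -1 else 0)
                  * hessKerAt (AffineAveraging.toSite (AveragingContoursRooted.ctrOff 4 Lc)) Lc ρ' w (β, ResolventReflection.bref α β x) (β', ResolventReflection.bref α β' z)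
              + 2 * (if ρ' = α then AveragingHessianKernelsRooted.linKerAt (AffineAveraging.toSite (AveragingContoursRooted.ctrOff 4 Lc)) Lc ρ' w (κ, u) else 0)
                  * hessKerAt (AffineAveraging.toSite (AveragingContoursRooted.ctrOff 4 Lc)) Lc ρ' w (β, ResolventReflection.bref α β x) (β', ResolventReflection.bref α β' z))))
    (hBb : ∀ (α m : Fin 4) (y : Fin 4 → ℤ) (β : Fin 4) (x : Fin 4 → ℤ) (κ : Fin 4) (u : Fin 4 → ℤ) (κ' : Fin 4) (u' : Fin 4 → ℤ),
      PolarizationSign.reflSign α β * PolarizationSign.reflSign α κ * PolarizationSign.reflSign α κ' * PolarizationSign.reflSign α m *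
          (vh2KerAt (AffineAveraging.toSite (AveragingContoursRooted.ctrOff 4 Lc)) Lc m (ResolventReflection.bref α m y) (β, ResolventReflection.bref α β x) (κ, ResolventReflection.bref α κ u) (κ', ResolventReflection.bref α κ' u')
            + vh2KerAt (AffineAveraging.toSite (AveragingContoursRooted.ctrOff 4 Lc)) Lc m (ResolventReflection.bref α m y) (β, ResolventReflection.bref α β x) (κ', ResolventReflection.bref α κ' u') (κ, ResolventReflection.bref α κ u))
        = (vh2KerAt (AffineAveraging.toSite (AveragingContoursRooted.ctrOff 4 Lc)) Lc m y (β, x) (κ, u) (κ', u') + vh2KerAt (AffineAveraging.toSite (AveragingContoursRooted.ctrOff 4 Lc)) Lc m y (β, x) (κ', u') (κ, u))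
          + 2 * (vhKerAt (AffineAveraging.toSite (AveragingContoursRooted.ctrOff 4 Lc)) Lc m y (β, x) (κ', u')
                  * ((if m = α then AveragingHessianKernelsRooted.linKerAt (AffineAveraging.toSite (AveragingContoursRooted.ctrOff 4 Lc)) Lc m y (κ, u) else 0) - (if x = u ∧ β = κ ∧ κ = α then 1 else 0))
                + vhKerAt (AffineAveraging.toSite (AveragingContoursRooted.ctrOff 4 Lc)) Lc m y (β, x) (κ, u)
                  * ((if m = α then AveragingHessianKernelsRooted.linKerAt (AffineAveraging.toSite (AveragingContoursRooted.ctrOff 4 Lc)) Lc m y (κ', u') else 0) - (if x = u' ∧ β = κ' ∧ κ' = α then 1 else 0))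
                + AveragingHessianKernelsRooted.linKerAt (AffineAveraging.toSite (AveragingContoursRooted.ctrOff 4 Lc)) Lc m y (β, x)
                  * ((if m = α then AveragingHessianKernelsRooted.linKerAt (AffineAveraging.toSite (AveragingContoursRooted.ctrOff 4 Lc)) Lc m y (κ, u) else 0) - (if x = u ∧ β = κ ∧ κ = α then 1 else 0))
                  * ((if m = α then AveragingHessianKernelsRooted.linKerAt (AffineAveraging.toSite (AveragingContoursRooted.ctrOff 4 Lc)) Lc m y (κ', u') else 0) - (if x = u' ∧ β = κ' ∧ κ' = α then 1 else 0))))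
    :
    ∃ R2 : ℕ → Fin 4 → Fin 4 → (Fin 4 → ℤ) → Fin 4 → (Fin 4 → ℤ) → ExpKernelCalculus.MKer 4 (OneStepResolventKernel.Fib 3),
      (∀ (j : ℕ) (α : Fin 4), ∃ C δ : ℝ, 0 < δ ∧ BalabanCompositeJets.LocStencil₂ (R2 j α) C δ) ∧
      (∀ (j : ℕ) (α : Fin 4) κ u κ' u', TameKernelCalculus.trK (R2 j α κ u κ' u') = -BorderedHessian.sgnK (R2 j α κ u κ' u')) ∧
      ∀ (j : ℕ) (α κ : Fin 4) (u : Fin 4 → ℤ) (κ' : Fin 4) (u' : Fin 4 → ℤ),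
        SpineRooted.T2RecAt 3 Lc (AffineAveraging.toSite (AveragingContoursRooted.ctrOff 4 Lc)) ((Lc : ℝ) ^ 4) (-((Lc : ℝ) ^ 8 / 2)) cΛ ((Lc : ℝ) ^ 8) (-((Lc : ℝ) ^ 12 / 4)) ((8 * (N : ℝ) ^ 2)⁻¹ • WilsonVertex2Sym.wsym22 N) (SecondOrderSocketIdentification.vh₂SAn1 Lc) (AveragingMixedJetTables.mixFFAt (AffineAveraging.toSite (AveragingContoursRooted.ctrOff 4 Lc)) Lc) j κ (ResolventReflection.bref α κ u) κ' (ResolventReflection.bref α κ' u') =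
          (PolarizationSign.reflSign α κ * PolarizationSign.reflSign α κ') • KernelReflection.refK (ResolventReflection.Φ Lc α)
            (SpineRooted.T2RecAt 3 Lc (AffineAveraging.toSite (AveragingContoursRooted.ctrOff 4 Lc)) ((Lc : ℝ) ^ 4) (-((Lc : ℝ) ^ 8 / 2)) cΛ ((Lc : ℝ) ^ 8) (-((Lc : ℝ) ^ 12 / 4)) ((8 * (N : ℝ) ^ 2)⁻¹ • WilsonVertex2Sym.wsym22 N) (SecondOrderSocketIdentification.vh₂SAn1 Lc) (AveragingMixedJetTables.mixFFAt (AffineAveraging.toSite (AveragingContoursRooted.ctrOff 4 Lc)) Lc) j κ u κ' u' +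
              ChartConjugation.conjW (BorderedHessian.bhKStepAt 3 (AffineAveraging.toSite (AveragingContoursRooted.ctrOff 4 Lc)) Lc j)
                (SpineRooted.SpureRecAt 3 Lc (AffineAveraging.toSite (AveragingContoursRooted.ctrOff 4 Lc)) ((Lc : ℝ) ^ 4) (-((Lc : ℝ) ^ 8 / 2)) cΛ j κ u)
                (SpineRooted.SpureRecAt 3 Lc (AffineAveraging.toSite (AveragingContoursRooted.ctrOff 4 Lc)) ((Lc : ℝ) ^ 4) (-((Lc : ℝ) ^ 8 / 2)) cΛ j κ' u')
                (BorderedHessian.diagK fun p c => γ j * BorderedHessian.ctGen 3 α Lc κ u p c) (BorderedHessian.diagK fun p c => γ j * BorderedHessian.ctGen 3 α Lc κ' u' p c) (BorderedHessian.diagK fun p c => γ j ^ 2 * (BorderedHessian.ctGen 3 α Lc κ u p c * BorderedHessian.ctGen 3 α Lc κ' u' p c)) +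
              R2 j α κ u κ' u') :=
  T2RecAt_bref_all_JsRowD1_of_letters hLc hN hΛ (-((Lc : ℝ) ^ 12 / 4)) γ hγ (tableLaw_iff_bondLaw.2 hMb)
    (borderInv_of_bondLaw hLc cΛ γ hγ hBb)

open Classical in
/-- NOT IN PRINT; OUR BOOKKEEPING.  §3 **… ⟸ THE BORDER REFLECTION BOND LAW `hBb` ALONE** (an3's mixed bond law `RootedMixedTableLaw.bondLaw` inside; `γ` instantiated) — twin of
`RowD1MixedDischarged.…_JsRowD1_of_borderBondLaw`. -/
theorem T2RecAt_bref_all_JsRowD1_of_borderBondLaw (hLc : Odd Lc) {N : ℕ} (hN : 2 ≤ N) {cΛ : ℝ}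
    (hΛ : cΛ * (Lc : ℝ) ^ 4 = 2)
    (hBb : ∀ (α m : Fin 4) (y : Fin 4 → ℤ) (β : Fin 4) (x : Fin 4 → ℤ) (κ : Fin 4) (u : Fin 4 → ℤ) (κ' : Fin 4) (u' : Fin 4 → ℤ),
      PolarizationSign.reflSign α β * PolarizationSign.reflSign α κ * PolarizationSign.reflSign α κ' * PolarizationSign.reflSign α m *
          (vh2KerAt (AffineAveraging.toSite (AveragingContoursRooted.ctrOff 4 Lc)) Lc m (ResolventReflection.bref α m y) (β, ResolventReflection.bref α β x) (κ, ResolventReflection.bref α κ u) (κ', ResolventReflection.bref α κ' u')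
            + vh2KerAt (AffineAveraging.toSite (AveragingContoursRooted.ctrOff 4 Lc)) Lc m (ResolventReflection.bref α m y) (β, ResolventReflection.bref α β x) (κ', ResolventReflection.bref α κ' u') (κ, ResolventReflection.bref α κ u))
        = (vh2KerAt (AffineAveraging.toSite (AveragingContoursRooted.ctrOff 4 Lc)) Lc m y (β, x) (κ, u) (κ', u') + vh2KerAt (AffineAveraging.toSite (AveragingContoursRooted.ctrOff 4 Lc)) Lc m y (β, x) (κ', u') (κ, u))
          + 2 * (vhKerAt (AffineAveraging.toSite (AveragingContoursRooted.ctrOff 4 Lc)) Lc m y (β, x) (κ', u')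
                  * ((if m = α then AveragingHessianKernelsRooted.linKerAt (AffineAveraging.toSite (AveragingContoursRooted.ctrOff 4 Lc)) Lc m y (κ, u) else 0) - (if x = u ∧ β = κ ∧ κ = α then 1 else 0))
                + vhKerAt (AffineAveraging.toSite (AveragingContoursRooted.ctrOff 4 Lc)) Lc m y (β, x) (κ, u)
                  * ((if m = α then AveragingHessianKernelsRooted.linKerAt (AffineAveraging.toSite (AveragingContoursRooted.ctrOff 4 Lc)) Lc m y (κ', u') else 0) - (if x = u' ∧ β = κ' ∧ κ' = α then 1 else 0))
                + AveragingHessianKernelsRooted.linKerAt (AffineAveraging.toSite (AveragingContoursRooted.ctrOff 4 Lc)) Lc m y (β, x)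
                  * ((if m = α then AveragingHessianKernelsRooted.linKerAt (AffineAveraging.toSite (AveragingContoursRooted.ctrOff 4 Lc)) Lc m y (κ, u) else 0) - (if x = u ∧ β = κ ∧ κ = α then 1 else 0))
                  * ((if m = α then AveragingHessianKernelsRooted.linKerAt (AffineAveraging.toSite (AveragingContoursRooted.ctrOff 4 Lc)) Lc m y (κ', u') else 0) - (if x = u' ∧ β = κ' ∧ κ' = α then 1 else 0))))
    :
    ∃ R2 : ℕ → Fin 4 → Fin 4 → (Fin 4 → ℤ) → Fin 4 → (Fin 4 → ℤ) → ExpKernelCalculus.MKer 4 (OneStepResolventKernel.Fib 3),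
      (∀ (j : ℕ) (α : Fin 4), ∃ C δ : ℝ, 0 < δ ∧ BalabanCompositeJets.LocStencil₂ (R2 j α) C δ) ∧
      (∀ (j : ℕ) (α : Fin 4) κ u κ' u', TameKernelCalculus.trK (R2 j α κ u κ' u') = -BorderedHessian.sgnK (R2 j α κ u κ' u')) ∧
      ∀ (j : ℕ) (α κ : Fin 4) (u : Fin 4 → ℤ) (κ' : Fin 4) (u' : Fin 4 → ℤ),
        SpineRooted.T2RecAt 3 Lc (AffineAveraging.toSite (AveragingContoursRooted.ctrOff 4 Lc)) ((Lc : ℝ) ^ 4) (-((Lc : ℝ) ^ 8 / 2)) cΛ ((Lc : ℝ) ^ 8) (-((Lc : ℝ) ^ 12 / 4)) ((8 * (N : ℝ) ^ 2)⁻¹ • WilsonVertex2Sym.wsym22 N) (SecondOrderSocketIdentification.vh₂SAn1 Lc) (AveragingMixedJetTables.mixFFAt (AffineAveraging.toSite (AveragingContoursRooted.ctrOff 4 Lc)) Lc) j κ (ResolventReflection.bref α κ u) κ' (ResolventReflection.bref α κ' u') =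
          (PolarizationSign.reflSign α κ * PolarizationSign.reflSign α κ') • KernelReflection.refK (ResolventReflection.Φ Lc α)
            (SpineRooted.T2RecAt 3 Lc (AffineAveraging.toSite (AveragingContoursRooted.ctrOff 4 Lc)) ((Lc : ℝ) ^ 4) (-((Lc : ℝ) ^ 8 / 2)) cΛ ((Lc : ℝ) ^ 8) (-((Lc : ℝ) ^ 12 / 4)) ((8 * (N : ℝ) ^ 2)⁻¹ • WilsonVertex2Sym.wsym22 N) (SecondOrderSocketIdentification.vh₂SAn1 Lc) (AveragingMixedJetTables.mixFFAt (AffineAveraging.toSite (AveragingContoursRooted.ctrOff 4 Lc)) Lc) j κ u κ' u' +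
              ChartConjugation.conjW (BorderedHessian.bhKStepAt 3 (AffineAveraging.toSite (AveragingContoursRooted.ctrOff 4 Lc)) Lc j)
                (SpineRooted.SpureRecAt 3 Lc (AffineAveraging.toSite (AveragingContoursRooted.ctrOff 4 Lc)) ((Lc : ℝ) ^ 4) (-((Lc : ℝ) ^ 8 / 2)) cΛ j κ u)
                (SpineRooted.SpureRecAt 3 Lc (AffineAveraging.toSite (AveragingContoursRooted.ctrOff 4 Lc)) ((Lc : ℝ) ^ 4) (-((Lc : ℝ) ^ 8 / 2)) cΛ j κ' u')
                (BorderedHessian.diagK fun p c => (fun j => -((Lc : ℝ) ^ 8 / 2) * wVH 3 Lc j / (stepScale 3 Lc j * (Lc : ℝ) ^ 4)) j * BorderedHessian.ctGen 3 α Lc κ u p c) (BorderedHessian.diagK fun p c => (fun j => -((Lc : ℝ) ^ 8 / 2) * wVH 3 Lc j / (stepScale 3 Lc j * (Lc : ℝ) ^ 4)) j * BorderedHessian.ctGen 3 α Lc κ' u' p c) (BorderedHessian.diagK fun p c => (fun j => -((Lc : ℝ) ^ 8 / 2) * wVH 3 Lc j / (stepScale 3 Lc j * (Lc : ℝ) ^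 4)) j ^ 2 * (BorderedHessian.ctGen 3 α Lc κ u p c * BorderedHessian.ctGen 3 α Lc κ' u' p c)) +
              R2 j α κ u κ' u') :=
  T2RecAt_bref_all_JsRowD1_of_bondLaws hLc hN hΛ
    (fun j => -((Lc : ℝ) ^ 8 / 2) * wVH 3 Lc j / (stepScale 3 Lc j * (Lc : ℝ) ^ 4)) (fun _ => rfl) (RootedMixedTableLaw.bondLaw hLc) hBb

/-- NOT IN PRINT; OUR BOOKKEEPING.  §4 **WANTED W-an2-1: THE QUARTIC TABLE-LEVEL REFLECTION LAW OF THE COMB TOWER AT THE LITERAL OF RECORD `JsRowD1Pin hLc N` — HYPOTHESES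
`Odd Lc`, `2 ≤ N` ONLY** (an3's border bond law `RootedBorderTableLaw.bondLaw` + the Λ-lock `lockΛ_pin`) — twin of `RootedBorderTableLaw.…_JsRowD1Pin`. -/
theorem T2RecAt_bref_all_JsRowD1Pin (hLc : Odd Lc) {N : ℕ} (hN : 2 ≤ N)
    :
    ∃ R2 : ℕ → Fin 4 → Fin 4 → (Fin 4 → ℤ) → Fin 4 → (Fin 4 → ℤ) → ExpKernelCalculus.MKer 4 (OneStepResolventKernel.Fib 3),
      (∀ (j : ℕ) (α : Fin 4), ∃ C δ : ℝ, 0 < δ ∧ BalabanCompositeJets.LocStencil₂ (R2 j α) C δ) ∧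
      (∀ (j : ℕ) (α : Fin 4) κ u κ' u', TameKernelCalculus.trK (R2 j α κ u κ' u') = -BorderedHessian.sgnK (R2 j α κ u κ' u')) ∧
      ∀ (j : ℕ) (α κ : Fin 4) (u : Fin 4 → ℤ) (κ' : Fin 4) (u' : Fin 4 → ℤ),
        SpineRooted.T2RecAt 3 Lc (AffineAveraging.toSite (AveragingContoursRooted.ctrOff 4 Lc)) ((Lc : ℝ) ^ 4) (-((Lc : ℝ) ^ 8 / 2)) (2 / (Lc : ℝ) ^ 4) ((Lc : ℝ) ^ 8) (-((Lc : ℝ) ^ 12 / 4)) ((8 * (N : ℝ) ^ 2)⁻¹ • WilsonVertex2Sym.wsym22 N) (SecondOrderSocketIdentification.vh₂SAn1 Lc) (AveragingMixedJetTables.mixFFAt (AffineAveraging.toSite (AveragingContoursRooted.ctrOff 4 Lc)) Lc) j κ (ResolventReflection.bref α κ u) κ' (ResolventReflection.bref α κ' u') =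
          (PolarizationSign.reflSign α κ * PolarizationSign.reflSign α κ') • KernelReflection.refK (ResolventReflection.Φ Lc α)
            (SpineRooted.T2RecAt 3 Lc (AffineAveraging.toSite (AveragingContoursRooted.ctrOff 4 Lc)) ((Lc : ℝ) ^ 4) (-((Lc : ℝ) ^ 8 / 2)) (2 / (Lc : ℝ) ^ 4) ((Lc : ℝ) ^ 8) (-((Lc : ℝ) ^ 12 / 4)) ((8 * (N : ℝ) ^ 2)⁻¹ • WilsonVertex2Sym.wsym22 N) (SecondOrderSocketIdentification.vh₂SAn1 Lc) (AveragingMixedJetTables.mixFFAt (AffineAveraging.toSite (AveragingContoursRooted.ctrOff 4 Lc)) Lc) j κ u κ' u' +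
              ChartConjugation.conjW (BorderedHessian.bhKStepAt 3 (AffineAveraging.toSite (AveragingContoursRooted.ctrOff 4 Lc)) Lc j)
                (SpineRooted.SpureRecAt 3 Lc (AffineAveraging.toSite (AveragingContoursRooted.ctrOff 4 Lc)) ((Lc : ℝ) ^ 4) (-((Lc : ℝ) ^ 8 / 2)) (2 / (Lc : ℝ) ^ 4) j κ u)
                (SpineRooted.SpureRecAt 3 Lc (AffineAveraging.toSite (AveragingContoursRooted.ctrOff 4 Lc)) ((Lc : ℝ) ^ 4) (-((Lc : ℝ) ^ 8 / 2)) (2 / (Lc : ℝ) ^ 4) j κ' u')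
                (BorderedHessian.diagK fun p c => (fun j => -((Lc : ℝ) ^ 8 / 2) * wVH 3 Lc j / (stepScale 3 Lc j * (Lc : ℝ) ^ 4)) j * BorderedHessian.ctGen 3 α Lc κ u p c) (BorderedHessian.diagK fun p c => (fun j => -((Lc : ℝ) ^ 8 / 2) * wVH 3 Lc j / (stepScale 3 Lc j * (Lc : ℝ) ^ 4)) j * BorderedHessian.ctGen 3 α Lc κ' u' p c) (BorderedHessian.diagK fun p c => (fun j => -((Lc : ℝ) ^ 8 / 2) * wVH 3 Lc j / (stepScale 3 Lc j * (Lc : ℝ) ^ 4)) j ^ 2 * (BorderedHessian.ctGen 3 α Lc κ u p c * BorderedHessian.ctGen 3 α Lc κ' u' p c)) +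
              R2 j α κ u κ' u') :=
  T2RecAt_bref_all_JsRowD1_of_borderBondLaw hLc hN (lockΛ_pin hLc) (RootedBorderTableLaw.bondLaw hLc)

end Summit.QuantumFields.BalabanUV.Beta.GAN24.CombQuarticTableLawLiteral

end
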